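import Mathlib
import HarnessLib

/-!
# `MatrixDescartes` census — the RESOLVENT ROLLE BOUND for `2 × 2` pivot pencils of negative pivot determinant
# (`Z₊(det F) ≤ 1 + Z₊(Φ)`, `Φ` an explicit polynomial; the e-free «resolvent profile» entry point)

HONEST FRAMING.  Object-search cell `pub-symmetroid`, seat `val-sym-mdr-p1` (generation 18); helper file `--supports` the crux item
stmt-ValiantsHypothesis-18050 (`Theses.LacunarySymmetroid.MatrixDescartes`, OPEN, on HOLD) with NO closure claim.  An INSTRUMENT for the
structural route to «rank-one (2,4)₁ = 8» (the last open piece is chamber (C) of the `1|3` split, `…PivotRankOneReductionOneThree`):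
nothing here bears on `MatrixDescartes` in its window, on `DoorA26` / `DoorA34`, registers / credences, or `VP ≠ VNP`.

THE RESOLVENT.  For a `2 × 2` pivot pencil `F = X^e J + G(X)` with `det J < 0` and `G(x) ⪰ 0` one has, at every `x > 0`,
`det F(x) = −δ y² + τ(x) y + π(x)` with `y = x^e`, `δ = −det J > 0`, `τ = tr(adj J · G)`, `π = det G ≥ 0`; so `det F(x) = 0 ⟺ x^e = R(x)`
and `det F(x) < 0 ⟺ x^e > R(x)`, where `R = (τ + √(τ² + 4δπ))/(2δ) ≥ 0` is the positive resolvent root (§2).  Rolle's theorem for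
`x ↦ R(x)/x^e` bounds the number `Z₊` of distinct positive roots of `det F` by one plus the number of positive critical points, and a critical
point `c` satisfies `R(c)·τ_e(c) + π_e(c) = 0` (`τ_e = xτ′ − eτ`, `π_e = xπ′ − 2eπ`), hence `Φ(c) = 0` for the explicit polynomial
`Φ = δ·π_e² + τ·τ_e·π_e − π·τ_e²` (§3).  MAIN THEOREM (`card_posRoots_le_one_add_of_resolvent`): **`Z₊(f) ≤ 1 + Z₊(Φ)`** for every real
polynomial `f` of this resolvent shape (any `τ, π ∈ ℝ[X]` with `π ≥ 0` and `τ² + 4δπ > 0` on `(0, ∞)`, `Φ ≠ 0`).  §1 is a generic ROLLE COUNT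
(`card_posRoots_le_card_add_one`): if the positive roots of `f` are the positive zeros of a function `φ` differentiable on `(0,∞)` whose critical
points lie in a finite set `T`, then `Z₊(f) ≤ #T + 1`.  The companion file `…PivotRankOneResolventPairForm` instantiates `τ, π, Φ` for four
rank-one letters and proves `Φ = W² + (τ² + 4δπ)·P_e` (critical points live where the e-signed pair form `P_e` is negative).

[folklore] Rolle's theorem (Mathlib `exists_hasDerivAt_eq_zero`), the quadratic formula, `Finset.orderEmbOfFin`.  No definitions, no named facts.
-/

-- `Summit.ValiantsHypothesis.ValiantsHypothesis.…` repeats a component by the D-0017 layout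
-- (single-conjunct summit), which the `dupNamespace` linter flags; the name is mandated.
set_option linter.dupNamespace false

namespace Summit.ValiantsHypothesis.ValiantsHypothesis.Theorems.LacunarySymmetroidMatrixDescartes.Pivot.Resolvent

open Polynomial Finset Set
open scoped BigOperators

/-! ## 1. A generic Rolle count for positive roots -/

/-- **ROLLE COUNT.**  Let the positive roots of a real polynomial `f` be exactly the positive zeros of a function `φ` that has a derivative
`φ′` at every point of `(0, ∞)`, and let the finite set `T` contain every positive zero of `φ′`.  Then `f` has at most `#T + 1` distinct
positive roots (between two consecutive positive roots Rolle's theorem puts a point of `T`, and these points increase strictly). [folklore] -/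
theorem card_posRoots_le_card_add_one (f : ℝ[X]) (φ φ' : ℝ → ℝ)
    (hφ : ∀ x, 0 < x → (φ x = 0 ↔ f.IsRoot x)) (hder : ∀ x, 0 < x → HasDerivAt φ (φ' x) x)
    (T : Finset ℝ) (hT : ∀ c, 0 < c → φ' c = 0 → c ∈ T) :
    (f.roots.toFinset.filter (fun t => 0 < t)).card ≤ T.card + 1 := by
  classical
  set S := f.roots.toFinset.filter (fun t => 0 < t) with hS
  obtain ⟨n, hn⟩ : ∃ n, S.card = n := ⟨_, rfl⟩
  rw [hn]
  set r := S.orderEmbOfFin hn with hr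
  have hrS : ∀ j, r j ∈ S := fun j => Finset.orderEmbOfFin_mem _ _ _
  have hrpos : ∀ j, 0 < r j := fun j => (Finset.mem_filter.1 (hrS j)).2
  have hrroot : ∀ j, f.IsRoot (r j) := fun j => by
    have h := (Finset.mem_filter.1 (hrS j)).1
    rw [Multiset.mem_toFinset] at h
    exact isRoot_of_mem_roots h
  have hmono : ∀ i j : Fin n, (i : ℕ) < j → r i < r j := fun i j h => r.strictMono (Fin.lt_def.2 h)
  -- Rolle between consecutive roots
  have hex : ∀ i : Fin (n - 1), ∃ c, r ⟨i, by omega⟩ < c ∧ c < r ⟨i + 1, by omega⟩ ∧ φ' c = 0 := by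
    intro i
    have hlt : r ⟨i, by omega⟩ < r ⟨i + 1, by omega⟩ := hmono _ _ (by simp)
    have ha : 0 < r ⟨i, by omega⟩ := hrpos _
    have hcont : ContinuousOn φ (Icc (r ⟨i, by omega⟩) (r ⟨i + 1, by omega⟩)) := by
      intro x hx
      exact (hder x (lt_of_lt_of_le ha hx.1)).continuousAt.continuousWithinAt
    have hends : φ (r ⟨i, by omega⟩) = φ (r ⟨i + 1, by omega⟩) := by
      rw [(hφ _ ha).2 (hrroot _), (hφ _ (hrpos _)).2 (hrroot _)]
    obtain ⟨c, hc, hc0⟩ := exists_hasDerivAt_eq_zero (f := φ) (f' := φ') hlt hcont hends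
      (fun x hx => hder x (ha.trans hx.1))
    exact ⟨c, hc.1, hc.2, hc0⟩
  choose c hc using hex
  have hcT : ∀ i : Fin (n - 1), c i ∈ T := fun i =>
    hT (c i) ((hrpos _).trans (hc i).1) (hc i).2.2
  have hcmono : StrictMono c := by
    intro i j hij
    have hij' : (i : ℕ) + 1 ≤ j := by
      have := Fin.lt_def.1 hij
      omega
    calc c i < r ⟨i + 1, by omega⟩ := (hc i).2.1
      _ ≤ r ⟨j, by omega⟩ := r.monotone (Fin.le_def.2 hij')
      _ < c j := (hc j).1
  have hcard : (Finset.univ : Finset (Fin (n - 1))).card ≤ T.card :=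
    Finset.card_le_card_of_injOn c (fun i _ => hcT i) (hcmono.injective.injOn)
  rw [Finset.card_univ, Fintype.card_fin] at hcard
  omega

/-- Polynomial form of the Rolle count: if every positive critical point of `φ` is a root of a polynomial `Ψ ≠ 0`, then
`Z₊(f) ≤ Z₊(Ψ) + 1`. [folklore] -/
theorem card_posRoots_le_card_posRoots_add_one (f Ψ : ℝ[X]) (hΨ : Ψ ≠ 0) (φ φ' : ℝ → ℝ)
    (hφ : ∀ x, 0 < x → (φ x = 0 ↔ f.IsRoot x)) (hder : ∀ x, 0 < x → HasDerivAt φ (φ' x) x)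
    (hcrit : ∀ c, 0 < c → φ' c = 0 → Ψ.IsRoot c) :
    (f.roots.toFinset.filter (fun t => 0 < t)).card ≤ (Ψ.roots.toFinset.filter (fun t => 0 < t)).card + 1 := by
  classical
  refine card_posRoots_le_card_add_one f φ φ' hφ hder _ fun c hc h0 => ?_
  rw [Finset.mem_filter, Multiset.mem_toFinset, mem_roots hΨ]
  exact ⟨hcrit c hc h0, hc⟩

/-! ## 2. The resolvent quadratic at a point -/

/-- **Resolvent factorisation.**  For `δ > 0`, `π ≥ 0` and any real `τ, y`:
`−δy² + τy + π = −δ·(y − R)·(y + R′)` with `R = (τ + S)/(2δ)`, `R′ = (S − τ)/(2δ)`, `S = √(τ² + 4δπ)`. [folklore: quadratic formula] -/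
theorem resolvent_factor (δ τ π y : ℝ) (hδ : 0 < δ) (hπ : 0 ≤ π) :
    -δ * y ^ 2 + τ * y + π
      = -δ * (y - (τ + Real.sqrt (τ ^ 2 + 4 * δ * π)) / (2 * δ)) * (y + (Real.sqrt (τ ^ 2 + 4 * δ * π) - τ) / (2 * δ)) := by
  set S := Real.sqrt (τ ^ 2 + 4 * δ * π) with hSdef
  have hS : S ^ 2 = τ ^ 2 + 4 * δ * π := Real.sq_sqrt (by positivity)
  have hδ0 : δ ≠ 0 := hδ.ne'
  have h1 : -δ * (y - (τ + S) / (2 * δ)) * (y + (S - τ) / (2 * δ)) = -δ * y ^ 2 + τ * y + (S ^ 2 - τ ^ 2) / (4 * δ) := by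
    field_simp
    ring
  rw [h1, hS]
  field_simp
  ring

/-- The second resolvent root is non-positive: `R′ = (S − τ)/(2δ) ≥ 0`, i.e. `S ≥ τ`. [folklore] -/
theorem sqrt_disc_sub_nonneg (δ τ π : ℝ) (hδ : 0 < δ) (hπ : 0 ≤ π) :
    0 ≤ (Real.sqrt (τ ^ 2 + 4 * δ * π) - τ) / (2 * δ) := by
  apply div_nonneg _ (by positivity)
  have h1 : τ ≤ Real.sqrt (τ ^ 2 + 4 * δ * π) := by
    calc τ ≤ |τ| := le_abs_self τ
      _ = Real.sqrt (τ ^ 2) := (Real.sqrt_sq_eq_abs τ).symm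
      _ ≤ Real.sqrt (τ ^ 2 + 4 * δ * π) := Real.sqrt_le_sqrt (by nlinarith)
  linarith

/-- The positive resolvent root is non-negative: `R = (τ + S)/(2δ) ≥ 0`. [folklore] -/
theorem resolventRoot_nonneg (δ τ π : ℝ) (hδ : 0 < δ) (hπ : 0 ≤ π) :
    0 ≤ (τ + Real.sqrt (τ ^ 2 + 4 * δ * π)) / (2 * δ) := by
  apply div_nonneg _ (by positivity)
  have h1 : -τ ≤ Real.sqrt (τ ^ 2 + 4 * δ * π) := by
    calc -τ ≤ |τ| := neg_le_abs τ
      _ = Real.sqrt (τ ^ 2) := (Real.sqrt_sq_eq_abs τ).symm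
      _ ≤ Real.sqrt (τ ^ 2 + 4 * δ * π) := Real.sqrt_le_sqrt (by nlinarith)
  linarith

/-- **Roots are resolvent crossings.**  For `δ > 0`, `π ≥ 0`, `y > 0`: `−δy² + τy + π = 0 ⟺ y = R`. [folklore] -/
theorem resolvent_eq_zero_iff (δ τ π y : ℝ) (hδ : 0 < δ) (hπ : 0 ≤ π) (hy : 0 < y) :
    -δ * y ^ 2 + τ * y + π = 0 ↔ y = (τ + Real.sqrt (τ ^ 2 + 4 * δ * π)) / (2 * δ) := by
  rw [resolvent_factor δ τ π y hδ hπ]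
  have hpos : 0 < y + (Real.sqrt (τ ^ 2 + 4 * δ * π) - τ) / (2 * δ) := by
    have := sqrt_disc_sub_nonneg δ τ π hδ hπ; linarith
  constructor
  · intro h
    rcases mul_eq_zero.1 h with h1 | h1
    · rcases mul_eq_zero.1 h1 with h2 | h2
      · exfalso; linarith
      · linarith
    · exfalso; linarith
  · intro h; rw [h]; ring

/-- **Windows are resolvent excesses.**  For `δ > 0`, `π ≥ 0`, `y > 0`: `−δy² + τy + π < 0 ⟺ R < y`. [folklore] -/
theorem resolvent_neg_iff (δ τ π y : ℝ) (hδ : 0 < δ) (hπ : 0 ≤ π) (hy : 0 < y) :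
    -δ * y ^ 2 + τ * y + π < 0 ↔ (τ + Real.sqrt (τ ^ 2 + 4 * δ * π)) / (2 * δ) < y := by
  rw [resolvent_factor δ τ π y hδ hπ]
  have hpos : 0 < y + (Real.sqrt (τ ^ 2 + 4 * δ * π) - τ) / (2 * δ) := by
    have := sqrt_disc_sub_nonneg δ τ π hδ hπ; linarith
  set R := (τ + Real.sqrt (τ ^ 2 + 4 * δ * π)) / (2 * δ)
  set R' := (Real.sqrt (τ ^ 2 + 4 * δ * π) - τ) / (2 * δ)
  constructor
  · intro h
    by_contra hc
    push Not at hc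
    have : 0 ≤ -δ * (y - R) * (y + R') := by
      have h1 : -δ * (y - R) = δ * (R - y) := by ring
      rw [h1]; exact mul_nonneg (mul_nonneg hδ.le (by linarith)) hpos.le
    linarith
  · intro h
    have h1 : -δ * (y - R) * (y + R') = -(δ * (y - R) * (y + R')) := by ring
    rw [h1, neg_lt_zero]
    exact mul_pos (mul_pos hδ (by linarith)) hpos

/-- **Positivity before the crossing.**  For `δ > 0`, `π ≥ 0`, `y > 0`: `0 < −δy² + τy + π ⟺ y < R`. [folklore] -/
theorem resolvent_pos_iff (δ τ π y : ℝ) (hδ : 0 < δ) (hπ : 0 ≤ π) (hy : 0 < y) :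
    0 < -δ * y ^ 2 + τ * y + π ↔ y < (τ + Real.sqrt (τ ^ 2 + 4 * δ * π)) / (2 * δ) := by
  rw [resolvent_factor δ τ π y hδ hπ]
  have hpos : 0 < y + (Real.sqrt (τ ^ 2 + 4 * δ * π) - τ) / (2 * δ) := by
    have := sqrt_disc_sub_nonneg δ τ π hδ hπ; linarith
  set R := (τ + Real.sqrt (τ ^ 2 + 4 * δ * π)) / (2 * δ)
  set R' := (Real.sqrt (τ ^ 2 + 4 * δ * π) - τ) / (2 * δ)
  constructor
  · intro h
    by_contra hc
    push Not at hc
    have : -δ * (y - R) * (y + R') ≤ 0 := by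
      have h1 : -δ * (y - R) * (y + R') = -(δ * (y - R) * (y + R')) := by ring
      rw [h1, neg_nonpos]
      exact mul_nonneg (mul_nonneg hδ.le (by linarith)) hpos.le
    linarith
  · intro h
    have h1 : -δ * (y - R) = δ * (R - y) := by ring
    rw [h1]
    exact mul_pos (mul_pos hδ (by linarith)) hpos

/-! ## 3. The resolvent profile `R(x)/x^e`: derivative, critical equation, Rolle bound -/

/-- Derivative of the resolvent `R(x) = (τ(x) + √(τ(x)² + 4δπ(x)))/(2δ)` along polynomials `τ, π`, at a point where the discriminant
`τ² + 4δπ` is positive. [folklore: chain rule] -/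
theorem hasDerivAt_resolvent (δ : ℝ) (τ π : ℝ[X]) (x : ℝ) (hdisc : 0 < (τ.eval x) ^ 2 + 4 * δ * π.eval x) :
    HasDerivAt (fun x => (τ.eval x + Real.sqrt ((τ.eval x) ^ 2 + 4 * δ * π.eval x)) / (2 * δ))
      ((τ.derivative.eval x + (2 * τ.eval x * τ.derivative.eval x + 4 * δ * π.derivative.eval x)
          / (2 * Real.sqrt ((τ.eval x) ^ 2 + 4 * δ * π.eval x))) / (2 * δ)) x := by
  have hτ := τ.hasDerivAt x
  have hπ := π.hasDerivAt x
  have hD : HasDerivAt (fun x => (τ.eval x) ^ 2 + 4 * δ * π.eval x)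
      (2 * τ.eval x * τ.derivative.eval x + 4 * δ * π.derivative.eval x) x := by
    have h1 : HasDerivAt (fun x => (τ.eval x) ^ 2) (2 * τ.eval x * τ.derivative.eval x) x :=
      (hτ.fun_pow 2).congr_deriv (by push_cast; ring)
    have h2 : HasDerivAt (fun x => 4 * δ * π.eval x) (4 * δ * π.derivative.eval x) x := hπ.const_mul (4 * δ)
    exact h1.add h2
  have hS := hD.sqrt hdisc.ne'
  exact (hτ.add hS).div_const (2 * δ)

/-- **Critical equation.**  Write `R = (τ + S)/(2δ)`, `S = √(τ² + 4δπ) > 0`, `δ > 0`.  If `x·R′(x) = e·R(x)` (a critical point of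
`R(x)/x^e`), then `R(x)·τ_e(x) + π_e(x) = 0` with `τ_e = xτ′ − eτ`, `π_e = xπ′ − 2eπ`; consequently
`Φ(x) := δπ_e² + ττ_eπ_e − πτ_e² = 0`. [this file: `S·(xS′) = τ·xτ′ + 2δ·xπ′` and `S² = τ² + 4δπ`] -/
theorem resolvent_critical (δ e : ℝ) (τ π : ℝ[X]) (x : ℝ) (hδ : 0 < δ) (hdisc : 0 < (τ.eval x) ^ 2 + 4 * δ * π.eval x)
    (hcrit : x * ((τ.derivative.eval x + (2 * τ.eval x * τ.derivative.eval x + 4 * δ * π.derivative.eval x)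
          / (2 * Real.sqrt ((τ.eval x) ^ 2 + 4 * δ * π.eval x))) / (2 * δ))
        = e * ((τ.eval x + Real.sqrt ((τ.eval x) ^ 2 + 4 * δ * π.eval x)) / (2 * δ))) :
    ((τ.eval x + Real.sqrt ((τ.eval x) ^ 2 + 4 * δ * π.eval x)) / (2 * δ))
        * (x * τ.derivative.eval x - e * τ.eval x) + (x * π.derivative.eval x - 2 * e * π.eval x) = 0
    ∧ δ * (x * π.derivative.eval x - 2 * e * π.eval x) ^ 2
        + τ.eval x * (x * τ.derivative.eval x - e * τ.eval x) * (x * π.derivative.eval x - 2 * e * π.eval x)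
        - π.eval x * (x * τ.derivative.eval x - e * τ.eval x) ^ 2 = 0 := by
  set S := Real.sqrt ((τ.eval x) ^ 2 + 4 * δ * π.eval x) with hSdef
  have hSpos : 0 < S := Real.sqrt_pos.2 hdisc
  have hS2 : S ^ 2 = (τ.eval x) ^ 2 + 4 * δ * π.eval x := Real.sq_sqrt hdisc.le
  set t := τ.eval x; set t' := τ.derivative.eval x; set p := π.eval x; set p' := π.derivative.eval x
  have hδ0 : δ ≠ 0 := hδ.ne'
  have hS0 : S ≠ 0 := hSpos.ne'
  -- clear denominators in the critical equation
  have h1 : S * (x * t') + (t * (x * t') + 2 * δ * (x * p')) = e * (t + S) * S := by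
    have := hcrit
    field_simp at this
    linear_combination this / 2
  -- first claim: (t+S) τ_e + 2δ π_e = 0, divided by 2δ
  have h2 : (t + S) * (x * t' - e * t) + 2 * δ * (x * p' - 2 * e * p) = 0 := by
    linear_combination h1 + e * hS2
  refine ⟨?_, ?_⟩
  · have : (t + S) / (2 * δ) * (x * t' - e * t) + (x * p' - 2 * e * p)
        = ((t + S) * (x * t' - e * t) + 2 * δ * (x * p' - 2 * e * p)) / (2 * δ) := by
      field_simp
    rw [this, h2, zero_div]
  · -- square: S τ_e = −(t τ_e + 2δ π_e) ⇒ S² τ_e² = (t τ_e + 2δ π_e)²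
    have h3 : S * (x * t' - e * t) = -(t * (x * t' - e * t) + 2 * δ * (x * p' - 2 * e * p)) := by linear_combination h2
    have h4 : S ^ 2 * (x * t' - e * t) ^ 2 = (t * (x * t' - e * t) + 2 * δ * (x * p' - 2 * e * p)) ^ 2 := by
      calc S ^ 2 * (x * t' - e * t) ^ 2 = (S * (x * t' - e * t)) ^ 2 := by ring
        _ = (t * (x * t' - e * t) + 2 * δ * (x * p' - 2 * e * p)) ^ 2 := by rw [h3]; ring
    rw [hS2] at h4
    have h5 : 4 * δ * (δ * (x * p' - 2 * e * p) ^ 2 + t * (x * t' - e * t) * (x * p' - 2 * e * p)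
        - p * (x * t' - e * t) ^ 2) = 0 := by linear_combination -h4
    have h6 : (4 : ℝ) * δ ≠ 0 := by positivity
    exact (mul_eq_zero.1 h5).resolve_left h6

/-- **RESOLVENT ROLLE BOUND (main theorem).**  Let `δ > 0`, `e : ℕ`, `τ, π ∈ ℝ[X]` with `π(x) ≥ 0` and `τ(x)² + 4δπ(x) > 0` for `x > 0`,
and let `f ∈ ℝ[X]` satisfy `f(x) = −δx^{2e} + x^e τ(x) + π(x)` for `x > 0` (every `2 × 2` pivot pencil `X^e J + G(X)` with `det J = −δ < 0`,
`τ = tr(adj J·G)`, `π = det G`, `G(x) ⪰ 0`).  Put `τ_e = Xτ′ − eτ`, `π_e = Xπ′ − 2eπ`, `Φ = δπ_e² + ττ_eπ_e − πτ_e²`.  If `Φ ≠ 0` then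
**`Z₊(f) ≤ Z₊(Φ) + 1`**. [this file] -/
theorem card_posRoots_le_one_add_of_resolvent (δ : ℝ) (e : ℕ) (τ π f : ℝ[X]) (hδ : 0 < δ)
    (hπ : ∀ x, 0 < x → 0 ≤ π.eval x) (hdisc : ∀ x, 0 < x → 0 < (τ.eval x) ^ 2 + 4 * δ * π.eval x)
    (hf : ∀ x, 0 < x → f.eval x = -δ * (x ^ e) ^ 2 + τ.eval x * x ^ e + π.eval x)
    (hΦ : Polynomial.C δ * (X * π.derivative - Polynomial.C (2 * (e : ℝ)) * π) ^ 2
        + τ * (X * τ.derivative - Polynomial.C (e : ℝ) * τ) * (X * π.derivative - Polynomial.C (2 * (e : ℝ)) * π)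
        - π * (X * τ.derivative - Polynomial.C (e : ℝ) * τ) ^ 2 ≠ 0) :
    (f.roots.toFinset.filter (fun t => 0 < t)).card
      ≤ ((Polynomial.C δ * (X * π.derivative - Polynomial.C (2 * (e : ℝ)) * π) ^ 2
        + τ * (X * τ.derivative - Polynomial.C (e : ℝ) * τ) * (X * π.derivative - Polynomial.C (2 * (e : ℝ)) * π)
        - π * (X * τ.derivative - Polynomial.C (e : ℝ) * τ) ^ 2).roots.toFinset.filter (fun t => 0 < t)).card + 1 := by
  -- the profile φ(x) = R(x)/x^e − 1 and its derivative
  set R : ℝ → ℝ := fun x => (τ.eval x + Real.sqrt ((τ.eval x) ^ 2 + 4 * δ * π.eval x)) / (2 * δ) with hR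
  set R' : ℝ → ℝ := fun x => (τ.derivative.eval x + (2 * τ.eval x * τ.derivative.eval x + 4 * δ * π.derivative.eval x)
          / (2 * Real.sqrt ((τ.eval x) ^ 2 + 4 * δ * π.eval x))) / (2 * δ) with hR'
  refine card_posRoots_le_card_posRoots_add_one f _ hΦ (fun x => R x / x ^ e - 1)
    (fun x => (R' x * x ^ e - R x * ((e : ℝ) * x ^ (e - 1))) / (x ^ e) ^ 2) ?_ ?_ ?_
  · -- zeros of φ are the roots of f
    intro x hx
    have hxe : 0 < x ^ e := pow_pos hx e
    show R x / x ^ e - 1 = 0 ↔ f.IsRoot x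
    rw [sub_eq_zero, div_eq_one_iff_eq hxe.ne', IsRoot.def, hf x hx]
    have key := resolvent_eq_zero_iff δ (τ.eval x) (π.eval x) (x ^ e) hδ (hπ x hx) hxe
    constructor
    · intro h; exact key.2 h.symm
    · intro h; exact (key.1 h).symm
  · -- derivative of φ on (0, ∞)
    intro x hx
    have hxe : (x ^ e) ≠ 0 := (pow_pos hx e).ne'
    have hRd : HasDerivAt R (R' x) x := hasDerivAt_resolvent δ τ π x (hdisc x hx)
    have hpow : HasDerivAt (fun x : ℝ => x ^ e) ((e : ℝ) * x ^ (e - 1)) x := hasDerivAt_pow e x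
    exact (hRd.div hpow hxe).sub_const 1
  · -- critical points of φ are roots of Φ
    intro c hc h0
    have hce : 0 < c ^ e := pow_pos hc e
    have hnum : R' c * c ^ e - R c * ((e : ℝ) * c ^ (e - 1)) = 0 := by
      rcases div_eq_zero_iff.1 h0 with h | h
      · exact h
      · exfalso; exact (pow_pos hce 2).ne' h
    have hcrit : c * R' c = (e : ℝ) * R c := by
      rcases Nat.eq_zero_or_pos e with he | he
      · subst he
        simp at hnum
        simp [hnum]
      · have hce' : c ^ e = c * c ^ (e - 1) := by
          rw [← pow_succ']; congr 1; omega
        have h1 : (c * R' c - (e : ℝ) * R c) * c ^ (e - 1) = 0 := by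
          have : R' c * c ^ e - R c * ((e : ℝ) * c ^ (e - 1)) = (c * R' c - (e : ℝ) * R c) * c ^ (e - 1) := by
            rw [hce']; ring
          rw [← this]; exact hnum
        rcases mul_eq_zero.1 h1 with h | h
        · linarith
        · exfalso; exact (pow_pos hc (e - 1)).ne' h
    have key := (resolvent_critical δ (e : ℝ) τ π c hδ (hdisc c hc) hcrit).2
    rw [IsRoot.def]
    simp only [eval_add, eval_sub, eval_mul, eval_pow, eval_C, eval_X]
    linear_combination key

end Summit.ValiantsHypothesis.ValiantsHypothesis.Theorems.LacunarySymmetroidMatrixDescartes.Pivot.Resolvent
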